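import Mathlib
import Summits.NavierStokesRegularity.NavierStokesRegularity.Theorems.L3TimeExponentPincerRingPersistenceDynamics
import HarnessLib.Audit
import HarnessLib

/-!
# L3TimeExponentPincer — ring persistence: the transport pairing at a fixed time is
# `≤ 6 √(M √(‖η‖₁) √Q) · √(‖η⁻‖₁) · √(Q⁻)`

Support kernel for the crux `L3CascadeJaw` (route `L3TimeExponentPincer`, item
stmt-NavierStokesRegularity-19499), serving the PERSISTENCE LEMMA `LpPersistence 3 (1/2) 2`
(ROUND-11/12 of seat nsreg-p2).  Along a Tao-class solution from an axisymmetric swirl-free datum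
with `η₀ = ω_θ/r ∈ L¹`, `|η₀| ≤ M`, at a time `s` at which the moments `∫ r²η^±(s)` are finite
(which the weighted co-signed flux guarantees), the transport pairing that drives the weighted
co-signed flux obeys

`|∫ η⁻(s) · 2(x₀u₀ + x₁u₁)(s) dx| ≤ 6 √(M · √(∫|η(s)|) · √(∫ r²|η(s)|)) · √(∫ η⁻(s)) · √(∫ r²η⁻(s))`

(`transport_pairing_le`): speed bound `‖u‖ ≤ 3√(M ∫‖ω‖)`, `∫‖ω‖ ≤ √(∫|η|)√(∫r²|η|)`,
`|∫ η⁻ 2x_h·u| ≤ 2‖u‖_∞ ∫ rη⁻ ≤ 2‖u‖_∞ √(∫η⁻)√(∫r²η⁻)` (all from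
`L3TimeExponentPincerRingPersistenceDynamics`).  In the ring regime (`∫|η| ≤ m`, `∫η⁻ ≤ m⁻ ≪ m`,
`∫ r²|η| ≤ S`) this is `≤ 6 √M m^{1/4} √(m⁻) · S^{3/4}` — sub-linear in `S`, which is what lets
the absolute impulse stay bounded for `≍ Re` turnovers.  Also: the integrability package
`integrable_rsq_parts` (finite `ℝ≥0∞` moments ⇒ `r²η^±, r²η, r²|η| ∈ L¹`).

WHAT THIS IS NOT: not a statement about Navier–Stokes blow-up — an a-priori slice bound for
smooth swirl-free axisymmetric flows.
-/

namespace Summit.NavierStokesRegularity.NavierStokesRegularity.Theorems.L3TimeExponentPincerRingPersistenceSlice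

open MeasureTheory Set Real Literature.Analysis.FluidPDE
open Summit.NavierStokesRegularity.NavierStokesRegularity.Theorems.L3TimeExponentPincerRingPersistenceDynamics
open scoped ENNReal NNReal

section Slice

variable {T ν : ℝ} {u₀ : EuclideanSpace ℝ (Fin 3) → EuclideanSpace ℝ (Fin 3)}
  {u : ℝ → EuclideanSpace ℝ (Fin 3) → EuclideanSpace ℝ (Fin 3)}
  {p : ℝ → EuclideanSpace ℝ (Fin 3) → ℝ}

/-- A nonnegative continuous function with finite `∫⁻ ofReal` is integrable. -/
theorem integrable_of_lintegral_ofReal_lt_top {f : EuclideanSpace ℝ (Fin 3) → ℝ} (hc : Continuous f)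
    (h0 : ∀ x, 0 ≤ f x) (hfin : ∫⁻ x, ENNReal.ofReal (f x) < ⊤) : Integrable f :=
  ⟨hc.aestronglyMeasurable, (hasFiniteIntegral_iff_ofReal (ae_of_all _ h0)).2 hfin⟩

/-- **Integrability package at a fixed time.** Along a Tao-class solution (`0 < ν`, `0 < T`) from
an axisymmetric swirl-free datum with `η₀ ∈ L¹`, at a time `s ∈ [0, T]` with finite moments
`∫⁻ r²(Ω(s))^± < ∞`: `Ω(s)`, `(Ω(s))^±`, `r²(Ω(s))^±`, `r²Ω(s)`, `r²|Ω(s)|`, `r(Ω(s))⁻` are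
integrable. -/
theorem integrable_rsq_parts (h : IsTaoSolutionOn T ν u₀ u p) (hT : 0 < T) (hν : 0 < ν)
    (h0 : IsAxisymmetric u₀) (h0' : HasNoSwirl u₀) (hL1 : Integrable (angVortQuot u₀))
    {s : ℝ} (hs : s ∈ Icc 0 T)
    (hfp : ∫⁻ x, ENNReal.ofReal (cylRadius x ^ 2 * (angVortQuot (u s) x)⁺) < ⊤)
    (hfn : ∫⁻ x, ENNReal.ofReal (cylRadius x ^ 2 * (angVortQuot (u s) x)⁻) < ⊤) :
    Integrable (angVortQuot (u s)) ∧
    Integrable (fun x => (angVortQuot (u s) x)⁺) ∧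
    Integrable (fun x => (angVortQuot (u s) x)⁻) ∧
    Integrable (fun x => cylRadius x ^ 2 * (angVortQuot (u s) x)⁺) ∧
    Integrable (fun x => cylRadius x ^ 2 * (angVortQuot (u s) x)⁻) ∧
    Integrable (fun x => cylRadius x ^ 2 * angVortQuot (u s) x) ∧
    Integrable (fun x => cylRadius x ^ 2 * |angVortQuot (u s) x|) ∧
    Integrable (fun x => cylRadius x * (angVortQuot (u s) x)⁻) := by
  obtain ⟨hΩi, -⟩ := h.integrable_angVortQuot_of_datum hT hν h0 h0' hL1 hs
  have hΩc : Continuous (angVortQuot (u s)) :=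
    (contDiff_angVortQuot (n := 0) (by
      exact_mod_cast (h.classical.contDiff_velocity hs).of_le (by norm_cast))).continuous
  have hpc : Continuous fun x => (angVortQuot (u s) x)⁺ := by
    have e : (fun x => (angVortQuot (u s) x)⁺) = fun x => max (angVortQuot (u s) x) 0 :=
      funext fun x => by rw [posPart_def]
    rw [e]; exact hΩc.max continuous_const
  have hnc : Continuous fun x => (angVortQuot (u s) x)⁻ := by
    have e : (fun x => (angVortQuot (u s) x)⁻) = fun x => max (-angVortQuot (u s) x) 0 :=
      funext fun x => by rw [negPart_def]
    rw [e]; exact hΩc.neg.max continuous_const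
  have hr2 : Continuous fun x : EuclideanSpace ℝ (Fin 3) => cylRadius x ^ 2 := continuous_cylRadius.pow 2
  have hp : Integrable (fun x => (angVortQuot (u s) x)⁺) :=
    hΩi.norm.mono' hpc.aestronglyMeasurable (ae_of_all _ fun x => by
      rw [Real.norm_eq_abs, abs_of_nonneg (posPart_nonneg _), Real.norm_eq_abs]
      calc (angVortQuot (u s) x)⁺ ≤ (angVortQuot (u s) x)⁺ + (angVortQuot (u s) x)⁻ :=
            le_add_of_nonneg_right (negPart_nonneg _)
        _ = |angVortQuot (u s) x| := posPart_add_negPart _)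
  have hn : Integrable (fun x => (angVortQuot (u s) x)⁻) :=
    hΩi.norm.mono' hnc.aestronglyMeasurable (ae_of_all _ fun x => by
      rw [Real.norm_eq_abs, abs_of_nonneg (negPart_nonneg _), Real.norm_eq_abs]
      calc (angVortQuot (u s) x)⁻ ≤ (angVortQuot (u s) x)⁺ + (angVortQuot (u s) x)⁻ :=
            le_add_of_nonneg_left (posPart_nonneg _)
        _ = |angVortQuot (u s) x| := posPart_add_negPart _)
  have hrp : Integrable (fun x => cylRadius x ^ 2 * (angVortQuot (u s) x)⁺) :=
    integrable_of_lintegral_ofReal_lt_top (hr2.mul hpc) (fun x => mul_nonneg (sq_nonneg _)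
      (posPart_nonneg _)) hfp
  have hrn : Integrable (fun x => cylRadius x ^ 2 * (angVortQuot (u s) x)⁻) :=
    integrable_of_lintegral_ofReal_lt_top (hr2.mul hnc) (fun x => mul_nonneg (sq_nonneg _)
      (negPart_nonneg _)) hfn
  have hrΩ : Integrable (fun x => cylRadius x ^ 2 * angVortQuot (u s) x) := by
    refine (hrp.sub hrn).congr (ae_of_all _ fun x => ?_)
    show cylRadius x ^ 2 * (angVortQuot (u s) x)⁺ - cylRadius x ^ 2 * (angVortQuot (u s) x)⁻ = _
    rw [← mul_sub, posPart_sub_negPart]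
  have hrabs : Integrable (fun x => cylRadius x ^ 2 * |angVortQuot (u s) x|) := by
    refine (hrp.add hrn).congr (ae_of_all _ fun x => ?_)
    show cylRadius x ^ 2 * (angVortQuot (u s) x)⁺ + cylRadius x ^ 2 * (angVortQuot (u s) x)⁻ = _
    rw [← mul_add, posPart_add_negPart]
  have hr1n : Integrable (fun x => cylRadius x * (angVortQuot (u s) x)⁻) := by
    refine ((hn.add hrn).div_const 2).mono' ((continuous_cylRadius.mul hnc).aestronglyMeasurable)
      (ae_of_all _ fun x => ?_)
    rw [Real.norm_eq_abs, abs_of_nonneg (mul_nonneg (cylRadius_nonneg x) (negPart_nonneg _))]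
    show cylRadius x * (angVortQuot (u s) x)⁻ ≤
      ((angVortQuot (u s) x)⁻ + cylRadius x ^ 2 * (angVortQuot (u s) x)⁻) / 2
    nlinarith [mul_nonneg (sq_nonneg (cylRadius x - 1)) (negPart_nonneg (angVortQuot (u s) x))]
  exact ⟨hΩi, hp, hn, hrp, hrn, hrΩ, hrabs, hr1n⟩

/-- **The transport pairing at a fixed time.** Along a Tao-class solution (`0 < ν`, `0 < T`) from
an axisymmetric swirl-free datum `u₀` with `η₀ ∈ L¹` and `|η₀| ≤ M`, at a time `s ∈ [0, T]` with
finite moments `∫⁻ r²(Ω(s))^± < ∞`: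
`|∫ (Ω(s))⁻ · 2(x₀u₀ + x₁u₁)(s)| ≤
   6 √(M · (√(∫|Ω(s)|) · √(∫ r²|Ω(s)|))) · (√(∫ (Ω(s))⁻) · √(∫ r²(Ω(s))⁻))`. -/
theorem transport_pairing_le (h : IsTaoSolutionOn T ν u₀ u p) (hT : 0 < T) (hν : 0 < ν)
    (h0 : IsAxisymmetric u₀) (h0' : HasNoSwirl u₀) (hL1 : Integrable (angVortQuot u₀))
    {M : ℝ} (hM : ∀ x, |angVortQuot u₀ x| ≤ M) {s : ℝ} (hs : s ∈ Icc 0 T)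
    (hfp : ∫⁻ x, ENNReal.ofReal (cylRadius x ^ 2 * (angVortQuot (u s) x)⁺) < ⊤)
    (hfn : ∫⁻ x, ENNReal.ofReal (cylRadius x ^ 2 * (angVortQuot (u s) x)⁻) < ⊤) :
    |∫ x, (angVortQuot (u s) x)⁻ * (2 * (x 0 * u s x 0 + x 1 * u s x 1))| ≤
      6 * Real.sqrt (M * (Real.sqrt (∫ x, |angVortQuot (u s) x|) *
        Real.sqrt (∫ x, cylRadius x ^ 2 * |angVortQuot (u s) x|))) *
      (Real.sqrt (∫ x, (angVortQuot (u s) x)⁻) *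
        Real.sqrt (∫ x, cylRadius x ^ 2 * (angVortQuot (u s) x)⁻)) := by
  obtain ⟨hΩi, -, hn, -, hrn, hrΩ, -, hr1n⟩ := integrable_rsq_parts h hT hν h0 h0' hL1 hs hfp hfn
  have hM0 : 0 ≤ M := (abs_nonneg _).trans (hM 0)
  -- vorticity mass and the speed bound
  obtain ⟨hωint, hW⟩ := vorticityMass_le_sqrt h hT hν h0 h0' hs hΩi hrΩ
  set W : ℝ := ∫ y, ‖curl (u s) y‖ with hWdef
  have hW0 : 0 ≤ W := integral_nonneg fun _ => norm_nonneg _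
  have hB : ∀ x, ‖u s x‖ ≤ 3 * Real.sqrt (W * M) := fun x =>
    speed_le_of_vorticityMass h hT hν h0 h0' hM hs hωint x
  -- the pairing
  have h1 := abs_integral_mul_horizontal_le (f := fun x => (angVortQuot (u s) x)⁻) (w := u s)
    (fun x => negPart_nonneg _) hr1n hB
  have h2 := integral_cylRadius_mul_le_sqrt_of_nonneg (f := fun x => (angVortQuot (u s) x)⁻)
    (fun x => negPart_nonneg _) hn hrn
  have hsq : Real.sqrt (W * M) ≤ Real.sqrt (M * (Real.sqrt (∫ x, |angVortQuot (u s) x|) *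
      Real.sqrt (∫ x, cylRadius x ^ 2 * |angVortQuot (u s) x|))) := by
    refine Real.sqrt_le_sqrt ?_
    rw [mul_comm]
    exact mul_le_mul_of_nonneg_left hW hM0
  have h3 : 0 ≤ ∫ x, cylRadius x * (angVortQuot (u s) x)⁻ :=
    integral_nonneg fun x => mul_nonneg (cylRadius_nonneg x) (negPart_nonneg _)
  calc |∫ x, (angVortQuot (u s) x)⁻ * (2 * (x 0 * u s x 0 + x 1 * u s x 1))|
      ≤ 2 * (3 * Real.sqrt (W * M)) * ∫ x, cylRadius x * (angVortQuot (u s) x)⁻ := h1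
    _ ≤ 2 * (3 * Real.sqrt (M * (Real.sqrt (∫ x, |angVortQuot (u s) x|) *
          Real.sqrt (∫ x, cylRadius x ^ 2 * |angVortQuot (u s) x|)))) *
          (Real.sqrt (∫ x, (angVortQuot (u s) x)⁻) *
            Real.sqrt (∫ x, cylRadius x ^ 2 * (angVortQuot (u s) x)⁻)) := by
        gcongr
    _ = _ := by ring

end Slice

/--
info: 'Summit.NavierStokesRegularity.NavierStokesRegularity.Theorems.L3TimeExponentPincerRingPersistenceSlice.transport_pairing_le' depends on axioms: [propext,
 Classical.choice,
 Quot.sound]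
-/
#guard_msgs in
#print axioms transport_pairing_le

end Summit.NavierStokesRegularity.NavierStokesRegularity.Theorems.L3TimeExponentPincerRingPersistenceSlice
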